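import Summits.NavierStokesRegularity.NavierStokesRegularity.Theorems.FilamentSkeletonRssCoreLinearInvertibilityClassClosureMoments
import Summits.NavierStokesRegularity.NavierStokesRegularity.Theorems.FilamentSkeletonRssCoreLinearInvertibilityClassClosureConv

/-!
# Stub `stub_classClosure` of crux `CoreLinearInvertibility` (stmt-NavierStokesRegularity-17973),
# route `FilamentSkeletonRss`, line `Sketch`: class closure in the graph norm of `T_{λ,R}`

Log of attempts (worker W2): v1 — tools A (weighted `L²` convergence), B (Gaussian weights, Young
bound for the nonlocal term), C (= `…Calc`: calculus of `T`, cut-offs), `…Moments`, `…Conv`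
(commutator → 0), and this assembly.

**Statement.** For `λ ∈ [0,1)`, `R ∈ ℝ` and `w ∈ C²(ℝ²)` with `w, T w, ∇w ∈ X_λ = L²(G_λ⁻¹dx)`,
pointwise absolutely convergent Biot–Savart integrals and zero mass and first moments, there are
`C²` compactly supported `w_k` with zero mass and first moments such that `‖w_k‖²_{X_λ} → ‖w‖²_{X_λ}`
and `‖T w_k‖²_{X_λ} → ‖T w‖²_{X_λ}`, where `T = T_{λ,R} = L_λ − R(⟪v^G, ∇·⟫ + ⟪K∗·, ∇G⟫)`.

**Proof.** `w_k = χ_k w − Σⱼ mⱼ(χ_k w) ηⱼ` with the radial cut-offs `χ_k = cutoff (k+1)`, the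
moments `m₀(v) = ∫ v`, `m₁(v) = ∫ x₀v`, `m₂(v) = ∫ x₁v`, and three fixed `C^∞_c` functions `ηⱼ` with
moment matrix the identity (part `…Moments`). Then `w_k ∈ C²_c` has zero moments; `mⱼ(χ_k w) → mⱼ(w)
= 0` (dominated convergence); `χ_k w − w → 0` in `X_λ` (dominated convergence) and
`T(χ_k w) − T w = A_k − R⟪K∗((χ_k−1)w), ∇G⟫ → 0` in `X_λ` (part `…Conv`); `T` is linear
(part `…Calc`) and `T ηⱼ ∈ X_λ`; so `w_k → w` and `T w_k → T w` in `X_λ`, and the squared norms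
converge (part A, weighted Cauchy–Schwarz).

References: Th. Gallay, Y. Maekawa, *Existence and stability of viscous vortices*,
arXiv:1610.08384, §4.1 (the spaces and operators); the truncation argument is folklore.
-/

set_option linter.dupNamespace false

noncomputable section

namespace Summit.NavierStokesRegularity.NavierStokesRegularity.Theorems

open Set Function Filter MeasureTheory Topology
open Literature.Analysis Literature.Analysis.FluidPDE
open Summit.AnomalousDissipation.AnomalousDissipation.Theorems.MarginalStabilityChainStretchedVortexRows
open scoped InnerProductSpace Laplacian ContDiff

section Combine

variable {lam : ℝ} {X : (ℕ → EuclideanSpace ℝ (Fin 2) → ℝ) → Prop}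
  (hX : ∀ φ : ℕ → EuclideanSpace ℝ (Fin 2) → ℝ, X φ ↔
    ((∀ k, AEStronglyMeasurable (φ k) volume) ∧
      (∀ k, Integrable (fun x => (gaussWeightLam lam x)⁻¹ * φ k x ^ 2)) ∧
        Tendsto (fun k => ∫ x, (gaussWeightLam lam x)⁻¹ * φ k x ^ 2) atTop (𝓝 0)))
include hX

/-- `X_λ`-convergence of `a − c₀ − c₁ − c₂` from that of the four pieces. [folklore] -/
theorem xconv_of_eq_comb₄ (hlam : lam < 1) {a c₀ c₁ c₂ d : ℕ → EuclideanSpace ℝ (Fin 2) → ℝ}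
    (ha : X a) (h0 : X c₀) (h1 : X c₁) (h2 : X c₂)
    (hd : ∀ k x, d k x = a k x - c₀ k x - c₁ k x - c₂ k x) : X d := by
  have : d = fun k x => a k x - c₀ k x - c₁ k x - c₂ k x := funext fun k => funext (hd k)
  rw [this]
  exact xconv_sub hX hlam (xconv_sub hX hlam (xconv_sub hX hlam ha h0) h1) h2

/-- `X_λ`-convergence of `a − b − c₀ − c₁ − c₂` from that of the five pieces. [folklore] -/
theorem xconv_of_eq_comb₅ (hlam : lam < 1) {a b c₀ c₁ c₂ d : ℕ → EuclideanSpace ℝ (Fin 2) → ℝ}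
    (ha : X a) (hb : X b) (h0 : X c₀) (h1 : X c₁) (h2 : X c₂)
    (hd : ∀ k x, d k x = a k x - b k x - c₀ k x - c₁ k x - c₂ k x) : X d :=
  xconv_of_eq_comb₄ hX hlam (xconv_sub hX hlam ha hb) h0 h1 h2 hd

end Combine

/-- **Stub 2 (class closure in the graph norm).** For `w` in the crux class with `∇w ∈ X_λ` and zero
mass and first moments there are `C²` compactly supported `w_k` with zero mass and first moments such
that `‖w_k‖²_{X_λ} → ‖w‖²_{X_λ}` and `‖T w_k‖²_{X_λ} → ‖T w‖²_{X_λ}` (radial cut-offs `χ_k w` corrected by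
three fixed bumps; the commutator `[T, χ_k]` tends to zero in `X_λ`). Registered stub of crux
stmt-NavierStokesRegularity-17973, line `Sketch`. [folklore] -/
theorem stub_classClosure :
    ∀ lam ∈ Set.Ico (0 : ℝ) 1, ∀ (R : ℝ) (w : EuclideanSpace ℝ (Fin 2) → ℝ), ContDiff ℝ 2 w →
    Integrable (fun x => (gaussWeightLam lam x)⁻¹ * w x ^ 2) →
    (∀ x, Integrable (fun y => w y • biotSavartKernel2D (x - y))) →
    Integrable (fun x => (gaussWeightLam lam x)⁻¹ * (strainedVorticityOperator lam w x -
      R * (⟪gaussVortexVelocity x, gradient w x⟫_ℝ +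
        ⟪biotSavart2D w x, gradient gaussVortexProfile x⟫_ℝ)) ^ 2) →
    Integrable (fun x => (gaussWeightLam lam x)⁻¹ * ‖gradient w x‖ ^ 2) →
    ∫ x, w x = 0 → ∫ x, x 0 * w x = 0 → ∫ x, x 1 * w x = 0 →
    ∃ ws : ℕ → EuclideanSpace ℝ (Fin 2) → ℝ,
      (∀ k, ContDiff ℝ 2 (ws k) ∧ HasCompactSupport (ws k) ∧ ∫ x, ws k x = 0 ∧
        ∫ x, x 0 * ws k x = 0 ∧ ∫ x, x 1 * ws k x = 0) ∧
      Tendsto (fun k => ∫ x, (gaussWeightLam lam x)⁻¹ * ws k x ^ 2) atTop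
        (𝓝 (∫ x, (gaussWeightLam lam x)⁻¹ * w x ^ 2)) ∧
      Tendsto (fun k => ∫ x, (gaussWeightLam lam x)⁻¹ * (strainedVorticityOperator lam (ws k) x -
        R * (⟪gaussVortexVelocity x, gradient (ws k) x⟫_ℝ +
          ⟪biotSavart2D (ws k) x, gradient gaussVortexProfile x⟫_ℝ)) ^ 2) atTop
        (𝓝 (∫ x, (gaussWeightLam lam x)⁻¹ * (strainedVorticityOperator lam w x -
          R * (⟪gaussVortexVelocity x, gradient w x⟫_ℝ +
            ⟪biotSavart2D w x, gradient gaussVortexProfile x⟫_ℝ)) ^ 2)) := by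
  intro lam hlam R w hw hwX hBS hTX hgrad hm0 hm1 hm2
  -- the operator `T`, abstractly
  obtain ⟨T, hT⟩ : ∃ T : ℝ → ℝ → (EuclideanSpace ℝ (Fin 2) → ℝ) → EuclideanSpace ℝ (Fin 2) → ℝ,
      ∀ (lam R : ℝ) (w : EuclideanSpace ℝ (Fin 2) → ℝ) (x : EuclideanSpace ℝ (Fin 2)),
        T lam R w x = strainedVorticityOperator lam w x -
          R * (⟪gaussVortexVelocity x, gradient w x⟫_ℝ +
            ⟪biotSavart2D w x, gradient gaussVortexProfile x⟫_ℝ) := ⟨_, fun _ _ _ _ => rfl⟩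
  simp only [← hT] at hTX ⊢
  -- `X φ`: "`φ_k → 0` in `X_λ`"
  obtain ⟨X, hX⟩ : ∃ X : (ℕ → EuclideanSpace ℝ (Fin 2) → ℝ) → Prop,
      ∀ φ : ℕ → EuclideanSpace ℝ (Fin 2) → ℝ, X φ ↔
        ((∀ k, AEStronglyMeasurable (φ k) volume) ∧
          (∀ k, Integrable (fun x => (gaussWeightLam lam x)⁻¹ * φ k x ^ 2)) ∧
            Tendsto (fun k => ∫ x, (gaussWeightLam lam x)⁻¹ * φ k x ^ 2) atTop (𝓝 0)) :=
    ⟨_, fun _ => Iff.rfl⟩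
  have hl1 : lam < 1 := hlam.2
  have hwc : Continuous w := hw.continuous
  have hwm : AEStronglyMeasurable w volume := hwc.aestronglyMeasurable
  obtain ⟨hwi, hw2⟩ := integrable_and_sq_of_memX hl1 hwm hwX
  -- the bump `φ` and the three moment-correction functions
  set φ : EuclideanSpace ℝ (Fin 2) → ℝ := fun y => FunctionSpaces.dyadicCutoff (EuclideanSpace ℝ (Fin 2)) y
    with hφdef
  have hφ : ContDiff ℝ 2 φ := (FunctionSpaces.dyadicCutoff (EuclideanSpace ℝ (Fin 2))).contDiff
  have hφc : HasCompactSupport φ := (FunctionSpaces.dyadicCutoff (EuclideanSpace ℝ (Fin 2))).hasCompactSupport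
  have hφev : ∀ x, φ (-x) = φ x := (FunctionSpaces.dyadicCutoff (EuclideanSpace ℝ (Fin 2))).neg
  have hI : 0 < ∫ y, φ y := (FunctionSpaces.dyadicCutoff (EuclideanSpace ℝ (Fin 2))).integral_pos
  obtain ⟨η₀, hη₀⟩ : ∃ η : EuclideanSpace ℝ (Fin 2) → ℝ, η = fun x => (∫ y, φ y)⁻¹ * φ x := ⟨_, rfl⟩
  obtain ⟨η₁, hη₁⟩ : ∃ η : EuclideanSpace ℝ (Fin 2) → ℝ,
      η = fun x => (∫ y, φ y)⁻¹ * (φ (x - EuclideanSpace.single 0 1) - φ x) := ⟨_, rfl⟩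
  obtain ⟨η₂, hη₂⟩ : ∃ η : EuclideanSpace ℝ (Fin 2) → ℝ,
      η = fun x => (∫ y, φ y)⁻¹ * (φ (x - EuclideanSpace.single 1 1) - φ x) := ⟨_, rfl⟩
  have hφt : ∀ e : EuclideanSpace ℝ (Fin 2), ContDiff ℝ 2 (fun x => φ (x - e)) ∧
      HasCompactSupport (fun x => φ (x - e)) := fun e =>
    ⟨hφ.comp (contDiff_id.sub contDiff_const), hφc.comp_homeomorph (Homeomorph.subRight e)⟩
  have hη₀d : ContDiff ℝ 2 η₀ := by rw [hη₀]; exact contDiff_const.mul hφ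
  have hη₁d : ContDiff ℝ 2 η₁ := by rw [hη₁]; exact contDiff_const.mul ((hφt _).1.sub hφ)
  have hη₂d : ContDiff ℝ 2 η₂ := by rw [hη₂]; exact contDiff_const.mul ((hφt _).1.sub hφ)
  have hη₀c : HasCompactSupport η₀ := by rw [hη₀]; exact hφc.mul_left
  have hη₁c : HasCompactSupport η₁ := by rw [hη₁]; exact ((hφt _).2.sub hφc).mul_left
  have hη₂c : HasCompactSupport η₂ := by rw [hη₂]; exact ((hφt _).2.sub hφc).mul_left
  -- moments of the `ηⱼ`: the identity matrix
  have hM₀ : (∫ x, η₀ x = 1) ∧ (∫ x : EuclideanSpace ℝ (Fin 2), x 0 * η₀ x = 0) ∧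
      (∫ x : EuclideanSpace ℝ (Fin 2), x 1 * η₀ x = 0) := by
    have h := moments_eta0 hφev hI
    rw [hη₀]
    exact ⟨h.1, h.2 0, h.2 1⟩
  have hM₁ : (∫ x, η₁ x = 0) ∧ (∫ x : EuclideanSpace ℝ (Fin 2), x 0 * η₁ x = 1) ∧
      (∫ x : EuclideanSpace ℝ (Fin 2), x 1 * η₁ x = 0) := by
    have h := moments_etaT hφ.continuous hφc hφev hI 0
    rw [hη₁]
    exact ⟨h.1, by simpa using h.2 0, by simpa using h.2 1⟩
  have hM₂ : (∫ x, η₂ x = 0) ∧ (∫ x : EuclideanSpace ℝ (Fin 2), x 0 * η₂ x = 0) ∧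
      (∫ x : EuclideanSpace ℝ (Fin 2), x 1 * η₂ x = 1) := by
    have h := moments_etaT hφ.continuous hφc hφev hI 1
    rw [hη₂]
    exact ⟨h.1, by simpa using h.2 0, by simpa using h.2 1⟩
  -- integrability, Biot–Savart integrability, `X_λ`-membership of the `ηⱼ` and of `T ηⱼ`
  have hηi : ∀ {η : EuclideanSpace ℝ (Fin 2) → ℝ}, ContDiff ℝ 2 η → HasCompactSupport η →
      Integrable η ∧ (∀ j : Fin 2, Integrable (fun x : EuclideanSpace ℝ (Fin 2) => x j * η x)) ∧
      (∀ x, Integrable (fun y => η y • biotSavartKernel2D (x - y))) ∧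
      Integrable (fun x => (gaussWeightLam lam x)⁻¹ * η x ^ 2) ∧
      AEStronglyMeasurable (T lam R η) volume ∧
      Integrable (fun x => (gaussWeightLam lam x)⁻¹ * T lam R η x ^ 2) := fun hη hηc =>
    ⟨hη.continuous.integrable_of_hasCompactSupport hηc,
      integrable_coord_mul_of_hasCompactSupport hη.continuous hηc,
      bsInt_of_hasCompactSupport hη.continuous hηc,
      integrable_inv_gaussWeightLam_mul_sq_of_hasCompactSupport hl1 hη.continuous hηc,
      coreOp_memX hT hlam hη hηc⟩
  obtain ⟨hη₀i, hη₀j, hη₀K, hη₀X, hTη₀m, hTη₀X⟩ := hηi hη₀d hη₀c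
  obtain ⟨hη₁i, hη₁j, hη₁K, hη₁X, hTη₁m, hTη₁X⟩ := hηi hη₁d hη₁c
  obtain ⟨hη₂i, hη₂j, hη₂K, hη₂X, hTη₂m, hTη₂X⟩ := hηi hη₂d hη₂c
  -- the cut-offs `u_k = χ_k w`
  obtain ⟨u, hu⟩ : ∃ u : ℕ → EuclideanSpace ℝ (Fin 2) → ℝ,
      u = fun (k : ℕ) x => cutoff ((k : ℝ) + 1) x * w x := ⟨_, rfl⟩
  have hud : ∀ k, ContDiff ℝ 2 (u k) := fun k => by
    rw [hu]; exact (contDiff_cutoff (n := 2) _).mul hw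
  have huc : ∀ k, HasCompactSupport (u k) := fun k => by
    rw [hu]; exact (hasCompactSupport_cutoff (by positivity)).mul_right
  have huK : ∀ k x, Integrable (fun y => u k y • biotSavartKernel2D (x - y)) := fun k => by
    rw [hu]
    exact bsInt_mul_of_abs_le_one (contDiff_cutoff (n := 0) _).continuous (abs_cutoff_le_one _) hwc hBS
  have hui : ∀ k, Integrable (u k) := fun k => (hud k).continuous.integrable_of_hasCompactSupport (huc k)
  have huj : ∀ k (j : Fin 2), Integrable (fun x : EuclideanSpace ℝ (Fin 2) => x j * u k x) := fun k =>
    integrable_coord_mul_of_hasCompactSupport (hud k).continuous (huc k)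
  -- the moments of `u_k` and their limits `mⱼ(u_k) → mⱼ(w) = 0`
  obtain ⟨m₀, hm₀⟩ : ∃ m : ℕ → ℝ, m = fun k => ∫ x, u k x := ⟨_, rfl⟩
  obtain ⟨m₁, hm₁⟩ : ∃ m : ℕ → ℝ, m = fun k => ∫ x : EuclideanSpace ℝ (Fin 2), x 0 * u k x := ⟨_, rfl⟩
  obtain ⟨m₂, hm₂⟩ : ∃ m : ℕ → ℝ, m = fun k => ∫ x : EuclideanSpace ℝ (Fin 2), x 1 * u k x := ⟨_, rfl⟩
  have hm₀t : Tendsto m₀ atTop (𝓝 0) := by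
    have h := tendsto_integral_cutoff_mul hwi
    rw [hm0] at h
    rw [hm₀, hu]
    exact h
  have hmjt : ∀ j : Fin 2, Tendsto (fun k => ∫ x : EuclideanSpace ℝ (Fin 2), x j * u k x) atTop (𝓝 0) := by
    intro j
    have h := tendsto_integral_cutoff_mul (integrable_coord_mul_of_memX hl1 hwm hwX j)
    have hj0 : ∫ x : EuclideanSpace ℝ (Fin 2), x j * w x = 0 := by
      fin_cases j
      · exact hm1
      · exact hm2
    rw [hj0] at h
    have he : (fun k => ∫ x : EuclideanSpace ℝ (Fin 2), x j * u k x) =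
        fun k : ℕ => ∫ x : EuclideanSpace ℝ (Fin 2), cutoff ((k : ℝ) + 1) x * (x j * w x) := by
      funext k
      rw [hu]
      congr 1
      funext x
      ring
    rw [he]
    exact h
  have hm₁t : Tendsto m₁ atTop (𝓝 0) := by rw [hm₁]; exact hmjt 0
  have hm₂t : Tendsto m₂ atTop (𝓝 0) := by rw [hm₂]; exact hmjt 1
  -- the approximants
  obtain ⟨ws, hws⟩ : ∃ ws : ℕ → EuclideanSpace ℝ (Fin 2) → ℝ,
      ws = fun k x => u k x - m₀ k * η₀ x - m₁ k * η₁ x - m₂ k * η₂ x := ⟨_, rfl⟩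
  refine ⟨ws, fun k => ⟨?_, ?_, ?_, ?_, ?_⟩, ?_, ?_⟩
  · simp only [hws]
    exact (((hud k).sub (contDiff_const.mul hη₀d)).sub (contDiff_const.mul hη₁d)).sub
      (contDiff_const.mul hη₂d)
  · simp only [hws]
    exact (((huc k).sub hη₀c.mul_left).sub hη₁c.mul_left).sub hη₂c.mul_left
  · -- mass
    simp only [hws]
    have hA : Integrable (fun x => u k x - m₀ k * η₀ x) := (hui k).sub (hη₀i.const_mul _)
    have hB : Integrable (fun x => u k x - m₀ k * η₀ x - m₁ k * η₁ x) := hA.sub (hη₁i.const_mul _)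
    rw [integral_sub hB (hη₂i.const_mul _), integral_sub hA (hη₁i.const_mul _),
      integral_sub (hui k) (hη₀i.const_mul _), integral_const_mul, integral_const_mul,
      integral_const_mul, hM₀.1, hM₁.1, hM₂.1, hm₀]
    ring
  · -- first moment `x₀`
    simp only [hws]
    rw [integral_mul_comb (m₀ k) (m₁ k) (m₂ k) (huj k 0) (hη₀j 0) (hη₁j 0) (hη₂j 0), hM₀.2.1,
      hM₁.2.1, hM₂.2.1, hm₁]
    ring
  · -- first moment `x₁`
    simp only [hws]
    rw [integral_mul_comb (m₀ k) (m₁ k) (m₂ k) (huj k 1) (hη₀j 1) (hη₁j 1) (hη₂j 1), hM₀.2.2,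
      hM₁.2.2, hM₂.2.2, hm₂]
    ring
  · -- `‖ws_k‖² → ‖w‖²`: `ws_k − w = (χ_k − 1) w − Σ mⱼ ηⱼ → 0` in `X_λ`
    refine tendsto_of_xconv hX hl1 hwm hwX (xconv_of_eq_comb₄ hX hl1 ?_
      (xconv_mul_of_tendsto_zero hX hm₀t hη₀d.continuous.aestronglyMeasurable hη₀X)
      (xconv_mul_of_tendsto_zero hX hm₁t hη₁d.continuous.aestronglyMeasurable hη₁X)
      (xconv_mul_of_tendsto_zero hX hm₂t hη₂d.continuous.aestronglyMeasurable hη₂X)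
      (a := fun k x => (cutoff ((k : ℝ) + 1) x - 1) * w x) (fun k x => by simp only [hws, hu]; ring))
    refine xconv_of_dominated hX hl1 (P := fun x => |w x|)
      (fun k => (((contDiff_cutoff (n := 0) _).continuous.sub continuous_const).mul hwc).aestronglyMeasurable)
      (by simpa only [sq_abs] using hwX) (fun k x => ?_) (fun x => ?_)
    · rw [abs_mul]
      calc |cutoff ((k : ℝ) + 1) x - 1| * |w x| ≤ 1 * |w x| :=
            mul_le_mul_of_nonneg_right (abs_cutoff_sub_one_le _ x) (abs_nonneg _)
        _ = |w x| := one_mul _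
    · simpa using ((tendsto_cutoff_natCast_add_one x).sub_const 1).mul_const (w x)
  · -- `‖T ws_k‖² → ‖T w‖²`
    have hA := xconv_cutoff_commutator_local hT hlam hw hBS hwX hTX hgrad (R := R)
    have hB := xconv_cutoff_commutator_nonlocal hlam R hwc hwX
    refine tendsto_of_xconv hX hl1 (aestronglyMeasurable_coreOp hT hw) hTX
      (xconv_of_eq_comb₅ hX hl1 ((hX _).2 hA) ((hX _).2 hB)
        (xconv_mul_of_tendsto_zero hX hm₀t hTη₀m hTη₀X)
        (xconv_mul_of_tendsto_zero hX hm₁t hTη₁m hTη₁X)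
        (xconv_mul_of_tendsto_zero hX hm₂t hTη₂m hTη₂X) (fun k x => ?_))
    simp only [hws]
    rw [coreOp_comb hT (hud k) hη₀d hη₁d hη₂d (huK k) hη₀K hη₁K hη₂K]
    simp only [hu]
    linear_combination coreOp_cutoff_mul_sub hT hw hBS ((k : ℝ) + 1) x (lam := lam) (R := R)

end Summit.NavierStokesRegularity.NavierStokesRegularity.Theorems
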